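import Summits.HodgeConjecture.HodgeConjecture.Theorems.R90S4TypeOneFinerCount   -- ★ p864472 F5b (this seat): `centralizer_eq_of_mem_member`, `member_eq_of_isConj` (+ ★ F5a `natCard_conjOrbit_eq_index`, the (B2-S) vocabulary)
import HarnessLib

/-!
# R90-TF · S4 «Ch. 13.1–2», (DICT) GENERIC ROW — `#{j : T_j = k} · [N(k):k] = |{t″ ∈ k : t″ ∼_{st} γ₀}|` FOR EVERY CARTAN TYPE (Rogawski 1990, §12.5 p. 182)

Cell `hodgecm-mathlib`, crux H413 (`stmt-HodgeConjecture-24833`, lane `--supports … --as helper`), route of record `HCCMUnconditional` (no route verbs; count-neutral).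
Programme R90-TF, section S4 (base `R90-C131`), dealer K2E2-plan (g8); seat R90-C131-p01 (g2).  THEOREMS ONLY; ★-only imports.  The type-free form of ★ F5b
`natCard_fiber_mul_index_eq_six` (there: type (1), right-hand side `6 = |S₃|`): the SAME double count with the stable set left uncounted, so that the (F1) row of ★ `IsFinerCount`
for types (2), (3), (0) is ONE LINE each once `|{t″ ∈ k : t″ ∼_{st} γ₀}|` (`= |Ω_F(T)|`: 2, 3 or 1, 2) is known — e.g. CARD A F3″ (type (2), `= 2`).

## THE MATHEMATICS
`C` a Cartan system of `G_v = U(Φ₃)(L⁺_v)` with CARTAN-ALL letters (2) (members are centralisers of regular elements) and (5) (pairwise non-conjugate); `γ₀ ∈ G_v` regular;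
`a : Fin m → G_v` a family of stable conjugates of `γ₀` with `a j ∈ T j ∈ C`, injective on `G_v`-classes and exhausting the classes of the stable class of `γ₀` (the (B) clause of a
member package at `γ₀`); `k ∈ C`.  Then (p. 182 verbatim) the classes meeting `k` are counted by `{j // T j = k}`, and each meets `S_k := {t″ ∈ k : t″ ∼_{st} γ₀}` in exactly one
`N_{G_v}(k)`-orbit, of `[N(k):k]` elements (★ F5a: stabiliser `Z(t″) = k`, conjugators between regular points of `k` normalise `k`).  Hence
`Nat.card {j // T j = k} · [N(k):k] = Nat.card S_k` — with NO finiteness hypothesis: if `S_k` is infinite both sides are `0` (`Nat.card` of an infinite type; an infinite `S_k` over the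
finite index set has an infinite fibre, whose cardinal IS the index).

## CONTENTS
* `natCard_fiber_mul_index_eq_natCard_stableSet` — the generic row.

HONEST LABEL: HC_CM is proved only modulo the 7 printed citations (2 remaining named inputs: hLiu418 = stmt-HodgeConjecture-24832, h413 = stmt-HodgeConjecture-24833) until rung 0
closes.  Generic input of the per-type (F1) rows of ★ `IsFinerCount` behind ★ (B2-S) behind the OPEN (W-NP); discharges no named input.  REL ≠ ★ ≠ BUILT.

## References
* [Rogawski1990] J. D. Rogawski, *Automorphic Representations of Unitary Groups in Three Variables*, Ann. of Math. Stud. 123 (1990), §12.5 p. 182; §3.6 pp. 28–31; §3.1 p. 19.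
-/

set_option autoImplicit false
set_option linter.dupNamespace false

noncomputable section

open NumberField IsDedekindDomain
open scoped MatrixGroups
open Literature.NumberTheory.Rogawski1990 Literature.NumberTheory.Automorphic Literature.NumberTheory.Automorphic.UnitaryGroup
open Summit.HodgeConjecture.HodgeConjecture.Cruxes.H413

namespace Summit.HodgeConjecture.HodgeConjecture.R90.S4

section StableSetFiberCount

variable (L : Type) [Field L] [NumberField L] [IsCMField L] (v : HeightOneSpectrum (𝓞 ↥(maximalRealSubfield L)))

variable {L v}

/-- **`#{j : T_j = k} · [N(k):k] = |{t″ ∈ k : t″ ∼_{st} γ₀}|` FOR EVERY CARTAN TYPE** (no non-split hypothesis, no finiteness hypothesis).  Data: a Cartan system `C` with letters (2)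
`hZ` and (5) `hirr`; a regular `γ₀`; a family `a : Fin m → G_v` of stable conjugates of `γ₀` in members `T j ∈ C`, injective on classes (`hainj`) and exhausting the classes of the
stable class of `γ₀` (`hasurj`); a member `k ∈ C`.  Conclusion: `Nat.card {j // T j = k} * [N(k):k] = Nat.card {s : ↥k // γ₀ ∼_{st} s}` (p. 182: «the number of `ν ∈ 𝔇(T∕F)` with
`T^ν` conjugate to `T″`» times `|Ω(T″)|` is the number of stable conjugates of `γ₀` inside `T″`).  ★ F5b `natCard_fiber_mul_index_eq_six` is the type-(1) instance (`= 6`).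
[cite: Rogawski1990, §12.5 p. 182; §3.6 pp. 28–31] -/
theorem natCard_fiber_mul_index_eq_natCard_stableSet {Car : Finset (Subgroup (Gqs L v))}
    (hZ : ∀ T ∈ Car, ∃ γ : Gqs L v, IsRegularElt (γ.val : GL (Fin 3) (LocalRing L v)) ∧ T = Subgroup.centralizer ({γ} : Set (Gqs L v)))
    (hirr : ∀ T ∈ Car, ∀ T' ∈ Car, (∃ x : Gqs L v, T.map (MulAut.conj x).toMonoidHom = T') → T = T')
    {γ₀ : Gqs L v} (hreg₀ : IsRegularElt (γ₀.val : GL (Fin 3) (LocalRing L v)))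
    {m : ℕ} {a : Fin m → Gqs L v} {T : Fin m → Subgroup (Gqs L v)} (hTmem : ∀ j, T j ∈ Car) (haT : ∀ j, a j ∈ T j)
    (hast : ∀ j, IsStablyConjGAt L (R90.S4.splitFormGL L) v γ₀ (a j))
    (hainj : ∀ j j', ConjClasses.mk (a j) = ConjClasses.mk (a j') → j = j')
    (hasurj : ∀ s : Gqs L v, IsStablyConjGAt L (R90.S4.splitFormGL L) v γ₀ s → ∃ j, ConjClasses.mk (a j) = ConjClasses.mk s)
    {k : Subgroup (Gqs L v)} (hk : k ∈ Car) :
    Nat.card {j : Fin m // T j = k} * (k.subgroupOf (Subgroup.normalizer (k : Set (Gqs L v)))).index =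
      Nat.card {s : ↥k // IsStablyConjGAt L (R90.S4.splitFormGL L) v γ₀ (s : Gqs L v)} := by
  classical
  have hareg : ∀ j, IsRegularElt ((a j).val : GL (Fin 3) (LocalRing L v)) := fun j => isRegularElt_of_isConj (hast j) hreg₀
  have haZ : ∀ j, Subgroup.centralizer ({a j} : Set (Gqs L v)) = T j := fun j => centralizer_eq_of_mem_member hZ (hTmem j) (haT j) (hareg j)
  -- every regular stable conjugate of `γ₀` inside a member `T'` pins the member
  have hpin : ∀ {T' : Subgroup (Gqs L v)}, T' ∈ Car → ∀ {s : Gqs L v}, s ∈ T' → IsStablyConjGAt L (R90.S4.splitFormGL L) v γ₀ s →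
      ∀ j, ConjClasses.mk (a j) = ConjClasses.mk s → T j = T' := by
    intro T' hT' s hs hst j hj
    exact member_eq_of_isConj hZ hirr (hTmem j) hT' (haT j) hs (hareg j) (isRegularElt_of_isConj hst hreg₀) (ConjClasses.mk_eq_mk_iff_isConj.1 hj)
  -- the class map `S_k → {j // T j = k}`
  have hfex : ∀ s : {s : ↥k // IsStablyConjGAt L (R90.S4.splitFormGL L) v γ₀ (s : Gqs L v)},
      ∃ j : {j : Fin m // T j = k}, ConjClasses.mk (a j.1) = ConjClasses.mk ((s.1 : Gqs L v)) := by
    intro s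
    obtain ⟨j, hj⟩ := hasurj (s.1 : Gqs L v) s.2
    exact ⟨⟨j, hpin hk (s.1).2 s.2 j hj⟩, hj⟩
  choose f hf using hfex
  -- each fibre is one `N(k)`-orbit of a regular point of `k`, of `[N(k):k]` elements
  have hfib : ∀ j : {j : Fin m // T j = k}, Nat.card {s // f s = j} = (k.subgroupOf (Subgroup.normalizer (k : Set (Gqs L v)))).index := by
    intro j
    have hajk : a j.1 ∈ k := by
      have h := haT j.1
      rw [j.2] at h
      exact h
    have hZj : Subgroup.centralizer ({a j.1} : Set (Gqs L v)) = k := by rw [haZ j.1, j.2]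
    rw [← natCard_conjOrbit_eq_index k hZj]
    refine Nat.card_congr (Equiv.ofBijective (fun s => ⟨((s.1.1 : Gqs L v)), ?_⟩) ⟨?_, ?_⟩)
    · have h1 : ConjClasses.mk (a j.1) = ConjClasses.mk ((s.1.1 : Gqs L v)) := by
        have h0 := hf s.1
        rw [s.2] at h0
        exact h0
      obtain ⟨c, hc'⟩ := isConj_iff.1 (ConjClasses.mk_eq_mk_iff_isConj.1 h1)
      have hsZ : Subgroup.centralizer ({((s.1.1 : Gqs L v))} : Set (Gqs L v)) = k :=
        centralizer_eq_of_mem_member hZ hk (s.1.1).2 (isRegularElt_of_isConj s.1.2 hreg₀)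
      exact ⟨c, mem_normalizer_of_conj_eq_of_centralizer_eq hZj hsZ hc', hc'⟩
    · intro s s' h
      simp only [Subtype.mk.injEq] at h
      exact Subtype.ext (Subtype.ext (Subtype.ext h))
    · rintro ⟨s', n, hn, hns'⟩
      have hs'k : s' ∈ k := by rw [← hns']; exact (Subgroup.mem_normalizer_iff.1 hn (a j.1)).1 hajk
      have hconj : IsConj (a j.1) s' := isConj_iff.2 ⟨n, hns'⟩
      have hst' : IsStablyConjGAt L (R90.S4.splitFormGL L) v γ₀ s' := IsConj.trans (hast j.1) (isStablyConjGAt_of_isConj hconj)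
      let s₀ : {s : ↥k // IsStablyConjGAt L (R90.S4.splitFormGL L) v γ₀ (s : Gqs L v)} := ⟨⟨s', hs'k⟩, hst'⟩
      have hfs₀ : f s₀ = j := by
        apply Subtype.ext
        apply hainj
        rw [hf s₀]
        exact (ConjClasses.mk_eq_mk_iff_isConj.2 hconj).symm
      exact ⟨⟨s₀, hfs₀⟩, rfl⟩
  -- count: finite case by fibrewise counting; infinite case: both sides vanish
  by_cases hfin : Finite {s : ↥k // IsStablyConjGAt L (R90.S4.splitFormGL L) v γ₀ (s : Gqs L v)}
  · exact (natCard_eq_natCard_mul_of_natCard_fiber_eq f _ hfib).symm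
  · haveI : Infinite {s : ↥k // IsStablyConjGAt L (R90.S4.splitFormGL L) v γ₀ (s : Gqs L v)} := not_finite_iff_infinite.1 hfin
    rw [Nat.card_eq_zero_of_infinite (α := {s : ↥k // IsStablyConjGAt L (R90.S4.splitFormGL L) v γ₀ (s : Gqs L v)})]
    -- some fibre is infinite, so the index (its cardinal) is `0`
    have hex : ∃ j : {j : Fin m // T j = k}, ¬ Finite {s // f s = j} := by
      by_contra hall
      simp only [not_exists, not_not] at hall
      haveI : ∀ j : {j : Fin m // T j = k}, Finite {s // f s = j} := hall
      exact hfin (Finite.of_equiv _ (Equiv.sigmaFiberEquiv f))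
    obtain ⟨j, hj⟩ := hex
    haveI : Infinite {s // f s = j} := not_finite_iff_infinite.1 hj
    rw [← hfib j, Nat.card_eq_zero_of_infinite (α := {s // f s = j}), mul_zero]

end StableSetFiberCount

end Summit.HodgeConjecture.HodgeConjecture.R90.S4

end
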